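import Literature.NumberTheory.Transcendental.LineJetArith
import Literature.NumberTheory.Transcendental.GeneratorValues
import Literature.NumberTheory.Transcendental.AlgMultiples
import Literature.NumberTheory.Transcendental.AlgebraicGeneratorsField
import HarnessLib

/-!
# The number field of Baker's method on `M_κ` and the generator values over it

Topic: `Literature/NumberTheory/Transcendental`. Plan item W4/S4 (first sub-brick) of the unit
`provefact-Literature.NumberTheory.Transcendental.H-b596640137`. For the Siegel and Liouville
steps every number entering the word forms `Λ_ω(P)` at the points `s·v` (`LineJetForms.lean`,
`LineODEModel.wordForm_eq_map`) must live in ONE number field `K`, with controlled denominators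
and conjugates. This file fixes that field and PROVES the controls:

* `BakerData` — the data: `g₂, g₃ ∈ ℚ̄`, a point `v ∈ Std.Alg` with torsion `E`-coordinates
  (`TorsionCoords L v N`, `N > 0`), and finitely many directions `x_m` with algebraic coordinates;
* `BakerData.BIdx`, `BakerData.gens : AlgGens` — the finite family
  `{g₂, g₃, κ_{eb}, (x_m)_k, e^{y_j(v)}, factor generators at r·v (r < N), Ñ_e(r·v) (r ≤ N)}`
  (algebraic by `isAlgebraic_coe_Kbar`, `AlgMultiples.isAlgebraic_genFun_zero_nsmul`), its number
  field `K = gens.K ⊂ ℂ`, common denominator `den` and conjugate bound `M` (`AlgebraicGeneratorsField`);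
* `BakerData.gK s : Gen → K` — **the generator values at `s·v` as elements of `K`**
  (`E_j = α_j^s`, factor generators `=` those at `(s mod N)·v`, `Ñ_e = ⌊s/N⌋·Ñ_e(N·v) + Ñ_e((s mod N)·v)`,
  by `GeneratorValues.lean`): `algebraMap_gK` identifies them with `genFun` at `s·v` (adapted chart),
  `isIntegral_den_pow_mul_gK` — `den^{s+1}·gK s i ∈ 𝓞_K`, `norm_embedding_gK_le` —
  `|σ(gK s i)| ≤ (s+1)·M^{s+1}` for every conjugate `σ`;

The `K`-models of the line derivation data and chart polynomials with their degree, size and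
denominator controls follow in the sequel (`BakerModels.lean`).

## References

* A. Baker, G. Wüstholz, *Logarithmic Forms and Diophantine Geometry*, CUP 2007, §6.8 (p. 119:
  the field `K`, "`log max |f_i(sv)| ≪ s`", denominators).
* A. Baker, *Transcendental Number Theory*, CUP 1975, Ch. 2 §3.
-/

noncomputable section

open Complex MvPolynomial
open scoped PeriodPair

namespace Literature.NumberTheory.Transcendental

namespace GaGmE

namespace Std

variable {β γ δ : Type} [Fintype β] [Fintype γ] [Fintype δ] [DecidableEq γ]

/-- **The data of Baker's method on `M_κ`**: algebraic invariants, a point of `Std.Alg` with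
`N`-torsion `E`-coordinates (`N > 0`) and finitely many directions with algebraic coordinates.
[cite: BakerWustholz2007, §6.8] -/
structure BakerData (β γ δ : Type) [Fintype β] [Fintype γ] [Fintype δ] [DecidableEq γ] where
  /-- the period pair -/
  L : PeriodPair
  /-- the extension data of `M_κ` -/
  κM : δ → γ → Kbar
  /-- `g₂ ∈ ℚ̄` -/
  h₂ : IsAlgebraic ℚ L.g₂
  /-- `g₃ ∈ ℚ̄` -/
  h₃ : IsAlgebraic ℚ L.g₃
  /-- the point -/
  v : β ⊕ (γ ⊕ δ) → ℂ
  /-- it is the logarithm of an algebraic point -/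
  hv : v ∈ Alg L κM
  /-- common torsion order of the `E`-coordinates -/
  N : ℕ
  /-- `N > 0` -/
  hN : 0 < N
  /-- lattice coordinates of `N z'_b(v)` -/
  tc : TorsionCoords L v N
  /-- number of directions -/
  dd : ℕ
  /-- the directions -/
  xs : Fin dd → β ⊕ (γ ⊕ δ) → ℂ
  /-- their coordinates are algebraic -/
  hxs : ∀ m k, IsAlgebraic ℚ (xs m k)

namespace BakerData

variable (B : BakerData β γ δ)

/-- Index type of the algebraic data generating the field `K`. [folklore] -/
inductive BIdx (B : BakerData β γ δ) : Type
  | g2 : BIdx B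
  | g3 : BIdx B
  | kap : δ → γ → BIdx B
  | dir : Fin B.dd → β ⊕ (γ ⊕ δ) → BIdx B
  | tor : β → BIdx B
  | fac : Fin B.N → γ → Fin 2 → BIdx B
  | fib : Fin (B.N + 1) → δ → BIdx B

/-- The index type is finite. [folklore] -/
instance instFintypeBIdx : Fintype B.BIdx := by
  classical
  exact Fintype.ofEquiv
    (Unit ⊕ Unit ⊕ (δ × γ) ⊕ (Fin B.dd × (β ⊕ (γ ⊕ δ))) ⊕ β ⊕ (Fin B.N × γ × Fin 2) ⊕ (Fin (B.N + 1) × δ))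
    { toFun := fun t => match t with
        | Sum.inl _ => BIdx.g2
        | Sum.inr (Sum.inl _) => BIdx.g3
        | Sum.inr (Sum.inr (Sum.inl ⟨e, b⟩)) => BIdx.kap e b
        | Sum.inr (Sum.inr (Sum.inr (Sum.inl ⟨m, k⟩))) => BIdx.dir m k
        | Sum.inr (Sum.inr (Sum.inr (Sum.inr (Sum.inl j)))) => BIdx.tor j
        | Sum.inr (Sum.inr (Sum.inr (Sum.inr (Sum.inr (Sum.inl ⟨r, b, i⟩))))) => BIdx.fac r b i
        | Sum.inr (Sum.inr (Sum.inr (Sum.inr (Sum.inr (Sum.inr ⟨r, e⟩))))) => BIdx.fib r e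
      invFun := fun t => match t with
        | BIdx.g2 => Sum.inl ()
        | BIdx.g3 => Sum.inr (Sum.inl ())
        | BIdx.kap e b => Sum.inr (Sum.inr (Sum.inl ⟨e, b⟩))
        | BIdx.dir m k => Sum.inr (Sum.inr (Sum.inr (Sum.inl ⟨m, k⟩)))
        | BIdx.tor j => Sum.inr (Sum.inr (Sum.inr (Sum.inr (Sum.inl j))))
        | BIdx.fac r b i => Sum.inr (Sum.inr (Sum.inr (Sum.inr (Sum.inr (Sum.inl ⟨r, b, i⟩)))))
        | BIdx.fib r e => Sum.inr (Sum.inr (Sum.inr (Sum.inr (Sum.inr (Sum.inr ⟨r, e⟩)))))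
      left_inv := fun t => by rcases t with _ | _ | ⟨_, _⟩ | ⟨_, _⟩ | _ | ⟨_, _, _⟩ | ⟨_, _⟩ <;> rfl
      right_inv := fun t => by cases t <;> rfl }

/-- The generator value at `r·v` in the adapted chart (independent of the direction argument,
which only enters at `ξ ≠ 0`). [folklore] -/
def genAt (r : ℕ) (i : Gen β γ δ) : ℂ :=
  genFun B.L B.κM (chartChoiceAt B.L ((r : ℂ) • B.v)) ((r : ℂ) • B.v) 0 0 i

omit [Fintype β] [Fintype δ] [DecidableEq γ] in
/-- At `ξ = 0` the generator values do not depend on the direction. [folklore] -/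
theorem genFun_zero_eq_genFun_zero (L : PeriodPair) (κM : δ → γ → Kbar) (c : γ → Bool)
    (w x : β ⊕ (γ ⊕ δ) → ℂ) (i : Gen β γ δ) :
    genFun L κM c w x 0 i = genFun L κM c w 0 0 i := by
  rcases i with j | ⟨b, i⟩ | e <;> simp [genFun]

/-- The algebraic data. [folklore] -/
def aVal : B.BIdx → ℂ
  | BIdx.g2 => B.L.g₂
  | BIdx.g3 => B.L.g₃
  | BIdx.kap e b => (B.κM e b : ℂ)
  | BIdx.dir m k => B.xs m k
  | BIdx.tor j => cexp (B.v (iy j))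
  | BIdx.fac r b i => B.genAt r (Sum.inr (Sum.inl (b, i)))
  | BIdx.fib r e => B.genAt r (Sum.inr (Sum.inr e))

/-- All the data are algebraic. [folklore] -/
theorem isAlgebraic_aVal (t : B.BIdx) : IsAlgebraic ℚ (B.aVal t) := by
  cases t with
  | g2 => exact B.h₂
  | g3 => exact B.h₃
  | kap e b => exact isAlgebraic_coe_Kbar _
  | dir m k => exact B.hxs m k
  | tor j => exact B.hv.1 j
  | fac r b i =>
    exact isAlgebraic_genFun_zero_nsmul B.κM B.h₂ B.h₃ B.hv r 0 (Sum.inr (Sum.inl (b, i)))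
  | fib r e =>
    exact isAlgebraic_genFun_zero_nsmul B.κM B.h₂ B.h₃ B.hv r 0 (Sum.inr (Sum.inr e))

/-- **The finite family of algebraic numbers of Baker's method on `M_κ`.** [cite: BakerWustholz2007, §6.8] -/
def gens : AlgGens := ⟨B.BIdx, B.aVal, B.isAlgebraic_aVal⟩

/-- The number field `K`. [cite: BakerWustholz2007, §6.8] -/
abbrev K : IntermediateField ℚ ℂ := B.gens.K

/-- The inclusion `K ⊂ ℂ` as a ring map. [folklore] -/
abbrev emb : B.K →+* ℂ := algebraMap B.K ℂ

/-- The `K`-valued datum with index `t`. [folklore] -/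
abbrev gK' (t : B.BIdx) : B.K := B.gens.genK t

/-- `emb (gK' t) = aVal t`. [folklore] -/
@[simp] theorem emb_gK' (t : B.BIdx) : B.emb (B.gK' t) = B.aVal t := rfl

/-! ### The generator values at `s·v` over `K` -/

/-- `s mod N` as an element of `Fin N`. [folklore] -/
def rmod (s : ℕ) : Fin B.N := ⟨s % B.N, Nat.mod_lt _ B.hN⟩

/-- `s mod N` as an element of `Fin (N+1)`. [folklore] -/
def rmod' (s : ℕ) : Fin (B.N + 1) := ⟨s % B.N, (Nat.mod_lt _ B.hN).trans (Nat.lt_succ_self _)⟩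

/-- `N` as an element of `Fin (N+1)`. [folklore] -/
def topN : Fin (B.N + 1) := ⟨B.N, Nat.lt_succ_self _⟩

/-- **The generator values at `s·v` as elements of `K`.** [cite: BakerWustholz2007, §6.8 (p. 119)] -/
def gK (s : ℕ) : Gen β γ δ → B.K
  | Sum.inl j => B.gK' (BIdx.tor j) ^ s
  | Sum.inr (Sum.inl (b, i)) => B.gK' (BIdx.fac (B.rmod s) b i)
  | Sum.inr (Sum.inr e) => ((s / B.N : ℕ) : B.K) * B.gK' (BIdx.fib B.topN e) + B.gK' (BIdx.fib (B.rmod' s) e)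

/-- **`gK s` are the generator values at `s·v`** (adapted chart, any direction). [folklore] -/
theorem emb_gK (s : ℕ) (x : β ⊕ (γ ⊕ δ) → ℂ) (i : Gen β γ δ) :
    B.emb (B.gK s i) = genFun B.L B.κM (chartChoiceAt B.L ((s : ℂ) • B.v)) ((s : ℂ) • B.v) x 0 i := by
  have hs : ((s / B.N * B.N + s % B.N : ℕ) : ℂ) = s := by rw [Nat.div_add_mod']
  rcases i with j | ⟨b, i⟩ | e
  · simp only [gK, map_pow, emb_gK', aVal]
    rw [genFun_torus_mul]
  · simp only [gK, emb_gK', aVal, genAt, rmod]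
    rw [genFun_zero_eq_genFun_zero _ _ _ _ x, ← hs, genFun_factor_mul B.κM B.tc]
  · simp only [gK, map_add, map_mul, map_natCast, emb_gK', aVal, genAt, rmod', topN]
    rw [genFun_zero_eq_genFun_zero _ _ _ _ x, ← hs, genFun_fibre_mul B.κM B.tc]

/-- The common denominator of the data. [folklore] -/
abbrev den : ℤ := B.gens.den

/-- **Denominators at `s·v`**: `den^{s+1} · gK s i ∈ 𝓞_K`. [cite: BakerWustholz2007, §6.8 (p. 119)] -/
theorem isIntegral_den_pow_mul_gK (s : ℕ) (i : Gen β γ δ) :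
    IsIntegral ℤ ((B.den : B.K) ^ (s + 1) * B.gK s i) := by
  have hd : IsIntegral ℤ (B.den : B.K) := isIntegral_intCast (B := B.K) _
  have hg : ∀ t, IsIntegral ℤ ((B.den : B.K) * B.gK' t) := B.gens.isIntegral_den_mul_genK
  rcases i with j | ⟨b, i⟩ | e
  · simp only [gK]
    have e1 : (B.den : B.K) ^ (s + 1) * B.gK' (BIdx.tor j) ^ s =
        (B.den : B.K) * ((B.den : B.K) * B.gK' (BIdx.tor j)) ^ s := by
      rw [mul_pow, pow_succ]; ring
    rw [e1]
    exact hd.mul ((hg _).pow _)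
  · simp only [gK]
    rw [pow_succ, mul_assoc]
    exact (hd.pow _).mul (hg _)
  · simp only [gK]
    have hq : IsIntegral ℤ ((s / B.N : ℕ) : B.K) := by
      exact_mod_cast isIntegral_intCast (B := B.K) ((s / B.N : ℕ) : ℤ)
    have e1 : (B.den : B.K) ^ (s + 1) *
        (((s / B.N : ℕ) : B.K) * B.gK' (BIdx.fib B.topN e) + B.gK' (BIdx.fib (B.rmod' s) e)) =
        (B.den : B.K) ^ s * (((s / B.N : ℕ) : B.K) * ((B.den : B.K) * B.gK' (BIdx.fib B.topN e)) +
          (B.den : B.K) * B.gK' (BIdx.fib (B.rmod' s) e)) := by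
      rw [pow_succ]; ring
    rw [e1]
    exact (hd.pow _).mul ((hq.mul (hg _)).add (hg _))

/-- The conjugate bound of the data (`≥ 1`). [folklore] -/
abbrev M : ℝ := B.gens.M

/-- **Conjugates at `s·v`**: `|σ(gK s i)| ≤ (s+1)·M^{s+1}` for every embedding `σ : K → ℂ`.
[cite: BakerWustholz2007, §6.8 (p. 119: log max |f_i(sv)| ≪ s)] -/
theorem norm_embedding_gK_le (σ : B.K →+* ℂ) (s : ℕ) (i : Gen β γ δ) :
    ‖σ (B.gK s i)‖ ≤ (s + 1) * B.M ^ (s + 1) := by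
  have hM : 1 ≤ B.M := B.gens.one_le_M
  have hg : ∀ t, ‖σ (B.gK' t)‖ ≤ B.M := B.gens.norm_embedding_genK_le σ
  have hM0 : 0 ≤ B.M := zero_le_one.trans hM
  have h1 : (1 : ℝ) ≤ (s + 1) := by
    have : (0 : ℝ) ≤ s := Nat.cast_nonneg s
    linarith
  rcases i with j | ⟨b, i⟩ | e
  · simp only [gK, map_pow, norm_pow]
    calc ‖σ (B.gK' (BIdx.tor j))‖ ^ s ≤ B.M ^ s := pow_le_pow_left₀ (norm_nonneg _) (hg _) s
      _ ≤ B.M ^ (s + 1) := pow_le_pow_right₀ hM (Nat.le_succ s)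
      _ ≤ (s + 1) * B.M ^ (s + 1) := le_mul_of_one_le_left (pow_nonneg hM0 _) h1
  · simp only [gK]
    calc ‖σ (B.gK' (BIdx.fac (B.rmod s) b i))‖ ≤ B.M := hg _
      _ = B.M ^ 1 := (pow_one _).symm
      _ ≤ B.M ^ (s + 1) := pow_le_pow_right₀ hM (Nat.succ_le_succ (Nat.zero_le s))
      _ ≤ (s + 1) * B.M ^ (s + 1) := le_mul_of_one_le_left (pow_nonneg hM0 _) h1
  · simp only [gK, map_add, map_mul, map_natCast]
    have hq : ((s / B.N : ℕ) : ℝ) ≤ s := by exact_mod_cast Nat.div_le_self s B.N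
    calc ‖((s / B.N : ℕ) : ℂ) * σ (B.gK' (BIdx.fib B.topN e)) + σ (B.gK' (BIdx.fib (B.rmod' s) e))‖
        ≤ ‖((s / B.N : ℕ) : ℂ) * σ (B.gK' (BIdx.fib B.topN e))‖ + ‖σ (B.gK' (BIdx.fib (B.rmod' s) e))‖ :=
          norm_add_le _ _
      _ ≤ (s : ℝ) * B.M + B.M := by
          rw [norm_mul, Complex.norm_natCast]
          exact add_le_add (mul_le_mul hq (hg _) (norm_nonneg _) (Nat.cast_nonneg s)) (hg _)
      _ = (s + 1) * B.M ^ 1 := by ring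
      _ ≤ (s + 1) * B.M ^ (s + 1) :=
          mul_le_mul_of_nonneg_left (pow_le_pow_right₀ hM (Nat.succ_le_succ (Nat.zero_le s)))
            (zero_le_one.trans h1)

end BakerData

end Std

end GaGmE

end Literature.NumberTheory.Transcendental

end
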